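import Summits.QuantumAdvantage.QuantumAdvantage.Theorems.CubicForrelationNearExactIsExactTwelveWindowStructure
import Summits.QuantumAdvantage.QuantumAdvantage.Theorems.CubicForrelationNearExactIsExactTwelveResidualDuality
import Summits.QuantumAdvantage.QuantumAdvantage.Theorems.CubicForrelationNearExactIsExactAffineForm

/-!
# Crux `CubicForrelation.NearExactIsExact` (stmt-QuantumAdvantage-14043) — n = 12 window `(59/64, 1)`: the odd hyperplane and
  two-sided periodicity of the residual

Certificate seat `b2b-cforr-cert` (gen 14).  HONEST FRAMING: lemmas (standard axioms) for the theorem `θ₁₂ ≤ 59/64`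
(`…TwelveWindow5964.lean`): finite-slice bookkeeping about cubic Boolean pairs on 12 bits, NOT summit progress.

Setting (from `window_twelve_structure`, gen 13): cubic `f, g` on 12 bits with `59/64 < Φ(f,g) < 1`; `W_g = 32·u'`, `P_g = {u' odd}`,
`u' = 2(−1)^f` off `P_g`; symmetrically `W_f = 32·v'`, `P_f = {v' odd}`.  Residuals `e_g = u' − 2(−1)^f`, `e_f = v' − 2(−1)^g`,
tied by `ê_g = −64·e_f` (`tw_residual_duality`).
* `tw59_budget`, `tw59_exists_even`: `Σ e_g² = 2¹⁵(1 − Φ) < 2560`, so `u'` is not odd everywhere;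
* `tw59_hyperplane`: `P_g = {x : (−1)^{γ·x} = t}` for some `γ ≠ 0`, `t = ±1` (`stub_walshTower` + `stub_affineForm`); `tw59_card_half`:
  such a set has `2048` points;
* `tw59_periodic_of_support` / `tw59_support_of_periodic`: a real function whose Walsh transform lives on `{(−1)^{c·z} = t}` satisfies
  `h(x ⊕ c) = t·h(x)`, and conversely (Walsh inversion `tz_inversion`);
* `tw59_residual_periodic`: hence `e_g(x ⊕ c_f) = t_f · e_g(x)` where `P_f = {(−1)^{c_f·z} = t_f}` — the two-sided input of the
  window theorem; `tw59_period_mem`: `(−1)^{γ·c_f} = 1` (the period is a direction of `P_g`).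

References: Ax (1964) / McEliece (1972); C. Carlet, *Boolean Functions for Cryptography and Coding Theory* (CUP 2021) §2.3 (Walsh
inversion); R. O'Donnell, *Analysis of Boolean Functions* (2014) §3.3.  Everything below is proved from Mathlib and the tree.
-/

set_option linter.dupNamespace false -- D-0017: single-problem summit ⇒ `QuantumAdvantage.QuantumAdvantage` by design

noncomputable section

namespace Summit.QuantumAdvantage.QuantumAdvantage.Theorems.CubicForrelation.NearExactIsExact

open Finset
open Literature.Computability.QuantumComplexity
open Literature.Computability.QuantumComplexity.BuzetChailloux (bxor zeroVec bxor_bxor_cancel_left bxor_zeroVec zeroVec_bxor bxor_comm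
  bxor_self twist_zeroVec_right twist_bxor_right bxorPerm bxorPerm_apply signOf_sq)
open Literature.Computability.QuantumComplexity.Simon (twist_eq_one_or)
open Literature.Computability.QuantumComplexity.DerivativeWalsh (W twist_bxor_left)

/-! ### Budget and the odd hyperplane -/

/-- The two-sided BUDGET at level 5 on 12 bits: `Σ_x (u' − 2(−1)^f)² = 2¹⁵(1 − Φ)` for `W_g = 32u'` (Parseval, `tw12_budget`).
[this work] -/
theorem tw59_budget (f g : (Fin (6 + 6) → Bool) → Bool) (u' : (Fin (6 + 6) → Bool) → ℤ)
    (hu' : ∀ x, W (fun y => signOf (g y)) x = (2 : ℝ) ^ 5 * (u' x : ℝ)) :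
    ((∑ x, (u' x - 2 * sZ (f x)) ^ 2 : ℤ) : ℝ) = 32768 * (1 - forrelation f g) := by
  set u : (Fin (6 + 6) → Bool) → ℤ := fun x => 2 * u' x with hudef
  have hu : ∀ x, W (fun y => signOf (g y)) x = (2 : ℝ) ^ 4 * (u x : ℝ) := by
    intro x; rw [hu' x]; simp only [u]; push_cast; ring
  have hbud := tw12_budget f g u hu
  have h4e : ∀ x, (u x - 4 * sZ (f x)) ^ 2 = 4 * (u' x - 2 * sZ (f x)) ^ 2 := fun x => by simp only [u]; ring
  have h' : ((∑ x, (u x - 4 * sZ (f x)) ^ 2 : ℤ) : ℝ) = 4 * ((∑ x, (u' x - 2 * sZ (f x)) ^ 2 : ℤ) : ℝ) := by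
    rw [sum_congr rfl fun x _ => h4e x, ← mul_sum]; push_cast; ring
  rw [h'] at hbud
  linarith

/-- An odd integer has square `≥ 1`. [folklore] -/
theorem tw59_one_le_sq_of_odd (m : ℤ) (hm : Odd m) : 1 ≤ m ^ 2 := by
  have hm0 : m ≠ 0 := by
    rintro rfl
    exact (by decide : ¬ Odd (0 : ℤ)) hm
  have h1 : 1 ≤ |m| := Int.one_le_abs hm0
  nlinarith [sq_abs m, abs_nonneg m]

/-- In the window `Φ > 59/64` the residual budget is `< 2560`, so `u'` is NOT odd everywhere (an everywhere-odd residual costs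
`≥ 4096`). [this work] -/
theorem tw59_exists_even (f g : (Fin (6 + 6) → Bool) → Bool) (u' : (Fin (6 + 6) → Bool) → ℤ)
    (hu' : ∀ x, W (fun y => signOf (g y)) x = (2 : ℝ) ^ 5 * (u' x : ℝ)) (hlo : (59 / 64 : ℝ) < forrelation f g) :
    ∃ y, ¬ Odd (u' y) := by
  by_contra hall
  push Not at hall
  have hB := tw59_budget f g u' hu'
  have h1 : ∀ x, (1 : ℤ) ≤ (u' x - 2 * sZ (f x)) ^ 2 := by
    intro x
    have hodd : Odd (u' x - 2 * sZ (f x)) := Int.odd_sub.2 (iff_of_true (hall x) ⟨sZ (f x), two_mul _⟩)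
    exact tw59_one_le_sq_of_odd _ hodd
  have hsum : (4096 : ℤ) ≤ ∑ x, (u' x - 2 * sZ (f x)) ^ 2 := by
    have h := Finset.sum_le_sum fun x (_ : x ∈ (univ : Finset (Fin (6 + 6) → Bool))) => h1 x
    have hc : ∑ _x : Fin (6 + 6) → Bool, (1 : ℤ) = 4096 := by
      rw [sum_const, card_univ, Fintype.card_fun, Fintype.card_bool, Fintype.card_fin]; norm_num
    linarith
  have h' : (4096 : ℝ) ≤ ((∑ x, (u' x - 2 * sZ (f x)) ^ 2 : ℤ) : ℝ) := by exact_mod_cast hsum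
  linarith

/-- `signOf b = −1` exactly when `b = true`. [folklore] -/
theorem tw59_signOf_eq_neg_one_iff (b : Bool) : signOf b = -1 ↔ b = true := by
  cases b <;> norm_num [signOf]

/-- **The odd set is an affine hyperplane.**  In the window, `{u' odd} = {x : (−1)^{γ·x} = t}` for some `γ ≠ 0` and a sign `t = ±1`
(`[u' odd]` has degree `≤ 1` by `stub_walshTower`, is written as a character by `stub_affineForm`, and is non-constant by
`tw59_exists_even` and the odd point). [this work] -/
theorem tw59_hyperplane (f g : (Fin (6 + 6) → Bool) → Bool) (hg : IsDegLeFun 3 g) (u' : (Fin (6 + 6) → Bool) → ℤ)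
    (hu' : ∀ x, W (fun y => signOf (g y)) x = (2 : ℝ) ^ 5 * (u' x : ℝ)) (hodd : ∃ x, Odd (u' x))
    (hlo : (59 / 64 : ℝ) < forrelation f g) :
    ∃ (γ : Fin (6 + 6) → Bool) (t : ℝ), (t = 1 ∨ t = -1) ∧ γ ≠ zeroVec ∧ ∀ x, (Odd (u' x) ↔ twist γ x = t) := by
  have hℓ : IsDegLeFun 1 (fun x => decide (Odd (u' x))) :=
    stub_walshTower stub_axParity (6 + 6) 5 1 g u' hg hu' (by intro k hk hkn; omega)
  obtain ⟨c, b, hcb⟩ := stub_affineForm (6 + 6) _ hℓ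
  have hsb : signOf b = 1 ∨ signOf b = -1 := by cases b <;> simp [signOf]
  have hiff : ∀ x, (Odd (u' x) ↔ twist c x = -signOf b) := by
    intro x
    have h1 := hcb x
    constructor
    · intro hx
      have h2 : signOf (decide (Odd (u' x))) = -1 := (tw59_signOf_eq_neg_one_iff _).2 (decide_eq_true hx)
      rw [h2] at h1
      rcases hsb with hs | hs <;> rw [hs] at h1 ⊢ <;> linarith
    · intro hx
      by_contra hno
      have h2 : signOf (decide (Odd (u' x))) = 1 := by simp [signOf, hno]
      rw [h2, hx] at h1
      rcases hsb with hs | hs <;> rw [hs] at h1 <;> linarith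
  refine ⟨c, -signOf b, ?_, ?_, hiff⟩
  · rcases hsb with hs | hs <;> rw [hs] <;> norm_num
  · intro hc
    have hconst : ∀ x y, (Odd (u' x) ↔ Odd (u' y)) := by
      intro x y
      rw [hiff x, hiff y, hc, twist_comm zeroVec x, twist_comm zeroVec y, twist_zeroVec_right, twist_zeroVec_right]
    obtain ⟨x, hx⟩ := hodd
    obtain ⟨y, hy⟩ := tw59_exists_even f g u' hu' hlo
    exact hy ((hconst x y).1 hx)

/-- A set `{x : (−1)^{γ·x} = t}` with `γ ≠ 0`, `t = ±1` has exactly `2048 = 2¹¹` points (character orthogonality). [folklore] -/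
theorem tw59_card_half (γ : Fin (6 + 6) → Bool) (hγ : γ ≠ zeroVec) (t : ℝ) (ht : t = 1 ∨ t = -1) :
    #(univ.filter fun x : Fin (6 + 6) → Bool => twist γ x = t) = 2048 := by
  have hsum : ∑ x : Fin (6 + 6) → Bool, twist γ x = 0 := by
    rw [Simon.sum_twist, if_neg]
    exact hγ
  have hsplit : ∑ x : Fin (6 + 6) → Bool, twist γ x =
      (#(univ.filter fun x : Fin (6 + 6) → Bool => twist γ x = 1) : ℝ) -
        #(univ.filter fun x : Fin (6 + 6) → Bool => ¬ twist γ x = 1) := by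
    have e : ∀ x : Fin (6 + 6) → Bool, twist γ x = if twist γ x = 1 then (1 : ℝ) else -1 := by
      intro x
      rcases twist_eq_one_or γ x with h | h
      · rw [if_pos h, h]
      · rw [if_neg (by rw [h]; norm_num), h]
    rw [sum_congr rfl fun x _ => e x, sum_ite, sum_const, sum_const, nsmul_eq_mul, nsmul_eq_mul]
    ring
  have hcard : #(univ.filter fun x : Fin (6 + 6) → Bool => twist γ x = 1) +
      #(univ.filter fun x : Fin (6 + 6) → Bool => ¬ twist γ x = 1) = 4096 := by
    rw [card_filter_add_card_filter_not, card_univ, Fintype.card_fun, Fintype.card_bool, Fintype.card_fin]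
    norm_num
  have hneg : (univ.filter fun x : Fin (6 + 6) → Bool => ¬ twist γ x = 1) =
      univ.filter fun x : Fin (6 + 6) → Bool => twist γ x = -1 := by
    refine filter_congr fun x _ => ?_
    rcases twist_eq_one_or γ x with h | h
    · rw [h]; norm_num
    · rw [h]; norm_num
  rw [hsplit] at hsum
  have h1 : #(univ.filter fun x : Fin (6 + 6) → Bool => twist γ x = 1) = 2048 := by
    have h' : (#(univ.filter fun x : Fin (6 + 6) → Bool => twist γ x = 1) : ℝ) =
        #(univ.filter fun x : Fin (6 + 6) → Bool => ¬ twist γ x = 1) := by linarith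
    have h'' : #(univ.filter fun x : Fin (6 + 6) → Bool => twist γ x = 1) =
        #(univ.filter fun x : Fin (6 + 6) → Bool => ¬ twist γ x = 1) := by exact_mod_cast h'
    omega
  rcases ht with ht | ht
  · rw [ht]; exact h1
  · rw [ht, ← hneg]; omega

/-! ### Periodicity ⟺ spectral support on a hyperplane -/

/-- If the Walsh transform of `h` lives on `{z : (−1)^{c·z} = t}`, then `h(x ⊕ c) = t·h(x)` (Walsh inversion). [folklore] -/
theorem tw59_periodic_of_support {n : ℕ} (h : (Fin n → Bool) → ℝ) (c : Fin n → Bool) (t : ℝ)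
    (hsupp : ∀ z, W h z ≠ 0 → twist c z = t) (x : Fin n → Bool) : h (bxor x c) = t * h x := by
  have h1 := tz_inversion h (bxor x c)
  have h2 := tz_inversion h x
  have e : ∀ z : Fin n → Bool, W h z * twist z (bxor x c) = t * (W h z * twist z x) := by
    intro z
    by_cases hz : W h z = 0
    · rw [hz]; ring
    · rw [twist_bxor_right, twist_comm z c, hsupp z hz]; ring
  rw [sum_congr rfl fun z _ => e z, ← mul_sum, h2] at h1
  have h2n : (2 : ℝ) ^ n ≠ 0 := by positivity
  have : (2 : ℝ) ^ n * h (bxor x c) = (2 : ℝ) ^ n * (t * h x) := by rw [← h1]; ring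
  exact mul_left_cancel₀ h2n this

/-- Conversely, if `h(x ⊕ c) = t·h(x)` with `t = ±1`, then `W_h` vanishes off `{z : (−1)^{c·z} = t}`. [folklore] -/
theorem tw59_support_of_periodic {n : ℕ} (h : (Fin n → Bool) → ℝ) (c : Fin n → Bool) (t : ℝ) (ht : t = 1 ∨ t = -1)
    (hper : ∀ x, h (bxor x c) = t * h x) (z : Fin n → Bool) (hz : twist c z ≠ t) : W h z = 0 := by
  have hre : W h z = ∑ x, h (bxor c x) * twist (bxor c x) z := by
    unfold W
    exact (Equiv.sum_comp (bxorPerm c) (fun x => h x * twist x z)).symm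
  have e : ∀ x : Fin n → Bool, h (bxor c x) * twist (bxor c x) z = (t * twist c z) * (h x * twist x z) := by
    intro x
    rw [bxor_comm c x, hper x, bxor_comm x c, twist_bxor_left]; ring
  rw [sum_congr rfl fun x _ => e x, ← mul_sum] at hre
  change W h z = t * twist c z * W h z at hre
  have hm : t * twist c z = -1 := by
    rcases twist_eq_one_or c z with hc | hc
    · rcases ht with rfl | rfl
      · exact absurd hc hz
      · rw [hc]; norm_num
    · rcases ht with rfl | rfl
      · rw [hc]; norm_num
      · exact absurd hc hz
  rw [hm] at hre
  linarith

/-! ### Application: the residual of a window pair is (anti)periodic along the partner's normal -/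

/-- **Two-sided periodicity.**  If `W_g = 32u'`, `W_f = 32v'`, the odd set of `v'` is the hyperplane `{(−1)^{c·z} = t_f}` and `f`'s
side is exact off it (`v' = 2(−1)^g` there), then the `g`-side residual satisfies `e_g(x ⊕ c) = t_f · e_g(x)` for every `x`
(`ê_g = −64 e_f` is supported on `P_f`; Walsh inversion). [this work] -/
theorem tw59_residual_periodic (f g : (Fin (6 + 6) → Bool) → Bool) (u' v' : (Fin (6 + 6) → Bool) → ℤ)
    (hu' : ∀ x, W (fun y => signOf (g y)) x = (2 : ℝ) ^ 5 * (u' x : ℝ))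
    (hv' : ∀ x, W (fun y => signOf (f y)) x = (2 : ℝ) ^ 5 * (v' x : ℝ))
    (c : Fin (6 + 6) → Bool) (tf : ℝ) (hPf : ∀ z, (Odd (v' z) ↔ twist c z = tf))
    (hofff : ∀ z, ¬ Odd (v' z) → v' z = 2 * sZ (g z)) (x : Fin (6 + 6) → Bool) :
    ((u' (bxor x c) - 2 * sZ (f (bxor x c)) : ℤ) : ℝ) = tf * ((u' x - 2 * sZ (f x) : ℤ) : ℝ) := by
  set h : (Fin (6 + 6) → Bool) → ℝ := fun x => ((u' x - 2 * sZ (f x) : ℤ) : ℝ) with hh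
  have hW : ∀ z, W h z = -64 * ((v' z - 2 * sZ (g z) : ℤ) : ℝ) := fun z => tw_residual_duality f g u' v' hu' hv' z
  have hsupp : ∀ z, W h z ≠ 0 → twist c z = tf := by
    intro z hz
    rw [hW z] at hz
    have hne : v' z - 2 * sZ (g z) ≠ 0 := by
      intro h0; apply hz; rw [h0]; push_cast; ring
    have hoz : Odd (v' z) := by
      by_contra hno
      exact hne (by rw [hofff z hno]; ring)
    exact (hPf z).1 hoz
  exact tw59_periodic_of_support h c tf hsupp x

/-- The period lies in the direction space of `P_g`: `(−1)^{γ·c} = 1` (the residual is non-zero exactly on `P_g`). [this work] -/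
theorem tw59_period_mem (f g : (Fin (6 + 6) → Bool) → Bool) (u' v' : (Fin (6 + 6) → Bool) → ℤ)
    (hu' : ∀ x, W (fun y => signOf (g y)) x = (2 : ℝ) ^ 5 * (u' x : ℝ))
    (hv' : ∀ x, W (fun y => signOf (f y)) x = (2 : ℝ) ^ 5 * (v' x : ℝ))
    (γ : Fin (6 + 6) → Bool) (tg : ℝ) (hPg : ∀ x, (Odd (u' x) ↔ twist γ x = tg)) (hodd : ∃ x, Odd (u' x))
    (hoffg : ∀ y, ¬ Odd (u' y) → u' y = 2 * sZ (f y))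
    (c : Fin (6 + 6) → Bool) (tf : ℝ) (htf : tf = 1 ∨ tf = -1) (hPf : ∀ z, (Odd (v' z) ↔ twist c z = tf))
    (hofff : ∀ z, ¬ Odd (v' z) → v' z = 2 * sZ (g z)) : twist γ c = 1 := by
  obtain ⟨x, hx⟩ := hodd
  have hex : (u' x - 2 * sZ (f x) : ℤ) ≠ 0 := by
    intro h0
    have hodd' : Odd (u' x - 2 * sZ (f x)) := Int.odd_sub.2 (iff_of_true hx ⟨sZ (f x), two_mul _⟩)
    rw [h0] at hodd'
    exact (Int.not_odd_iff_even.2 (by decide)) hodd'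
  have hper := tw59_residual_periodic f g u' v' hu' hv' c tf hPf hofff x
  have hexc : (u' (bxor x c) - 2 * sZ (f (bxor x c)) : ℤ) ≠ 0 := by
    intro h0
    rw [h0] at hper
    have htf0 : tf ≠ 0 := by rcases htf with h | h <;> rw [h] <;> norm_num
    have h00 : (((0 : ℤ)) : ℝ) = 0 := by norm_num
    rw [h00] at hper
    have hz : ((u' x - 2 * sZ (f x) : ℤ) : ℝ) = 0 := (mul_eq_zero.1 hper.symm).resolve_left htf0
    exact hex (by exact_mod_cast hz)
  have hoddc : Odd (u' (bxor x c)) := by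
    by_contra hno
    exact hexc (by rw [hoffg _ hno]; ring)
  have h1 := (hPg x).1 hx
  have h2 := (hPg (bxor x c)).1 hoddc
  rw [twist_bxor_right, h1] at h2
  rcases twist_eq_one_or γ c with h | h
  · exact h
  · exfalso
    rw [h] at h2
    have htg : tg = 1 ∨ tg = -1 := by rw [← h1]; exact twist_eq_one_or γ x
    rcases htg with ht | ht <;> rw [ht] at h2 <;> norm_num at h2

end Summit.QuantumAdvantage.QuantumAdvantage.Theorems.CubicForrelation.NearExactIsExact

end
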